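import Summits.HodgeConjecture.HodgeConjecture.Theorems.Ring2AbelianAllSpreadDiagonalLift
import Literature.AlgebraicGeometry.HodgeTheory.MotivatedClasses
import Literature.AlgebraicGeometry.HodgeTheory.MaximalPicardNumberHodgeClasses
import Literature.AlgebraicGeometry.HodgeTheory.HodgeTypeExteriorProduct
import Literature.AlgebraicGeometry.HodgeTheory.WeilSurfaceTestClassMultiplicities
import Literature.AlgebraicGeometry.HodgeTheory.WeilClassesHodgeType
import Literature.AlgebraicGeometry.HodgeTheory.AbelJacobiPullbackHodgeSection
import Literature.AlgebraicGeometry.HodgeTheory.NonCMEllipticCurvePowersHodgeClasses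
import Literature.AlgebraicGeometry.HodgeTheory.AbelianVarietyEndomorphismsHOne
import Literature.AlgebraicGeometry.HodgeTheory.SupportedClassesRational
import Literature.AlgebraicGeometry.HodgeTheory.HodgeClassOfMorphismProofs
import HarnessLib

/-!
# Ring 2 · AbelianAll · SPREADING, part XXII — the diagonal lift preserves rationality and Hodge type;
the PRIMITIVE LIFT `(PL-Δ)` as a theorem (fourth instalment of R2′; fact-free)

research route, not a corollary; conditional on HC_CM plus one named minimal statement.
(Cell line: research route conditional on HC_CM; not a corollary; Q11.4-sentence-2 already refuted in dim ≥ 3.)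

HONEST FRAMING (page 1). Research route, not a corollary: the target of this line is HC for all complex abelian
varieties CONDITIONAL on `HC_CM` (`Summit…Theses.RankFourFaces.CMAbelianHodge`, a hypothesis) plus ONE named
minimal statement `B_min`; the `B_min` of record is NOT changed by this file either (least typed node N103
`EvenPrimitiveHodgeFailureSpreadsToCMFibre`, part XVI; "minimal" is claimed nowhere) — what changes is recorded only
when the successor of part XVII re-keys its K[PL] rows on the theorem below (next part). This file proves, with no new
`def`, no `sorry` and no new named fact:
* `isRationalClass_of_diagonalLift` — the lift `Φ` of part XXI maps RATIONAL classes to rational classes: `H^{a+1}(A)` has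
  a `ℂ`-basis of rational monomials `b_{w 0} ⌣ ⋯ ⌣ b_{w a}` in a rational basis `b` of `H¹(A)` (`exists_basis_isRationalClass`,
  `span_range_cupPowOne_basis`, `exists_linearIndependent`), a rational class has rational coordinates in it
  (`repr_mem_range_ratCast_of_isRationalClass`), and `Φ` of a rational monomial is `((a+1)!)⁻¹ ∑_σ ±` (rational external
  products) by the monomial formula of part XXI.
* `isOfHodgeType_of_diagonalLift` — `Φ` maps classes of type `(p, p)` (`a + 1 = 2p`) to classes of type `(p, p)`: a
  `(p,p)`-class lies in the span of the BALANCED monomials (`AbelianVariety.mem_of_isOfHodgeType_of_balanced_mem`), and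
  `Φ` of a balanced monomial is a combination of external products `pr₀^* x_{σ 0} ⌣ ⋯ ⌣ pr_a^* x_{σ a}` of `p` classes of
  type `(1,0)` and `p` of type `(0,1)` (`isOfHodgeType_cupPowOne`, `IsOfHodgeType.map_of_isSmoothProjective`).
* `primitiveLift_diagonal` — **`(PL-Δ)`**: for every complex abelian variety `A` with `dim A ≥ 1`, every `p ≥ 1` and every
  rational class `c ∈ H^{2p}(A)` of type `(p,p)` there are a hard-Lefschetz datum `Λ'` of the self-power `A^{2p}`
  (`A.powSucc (2p-1)`, of EVEN dimension `2p · dim A ≥ 2p`) and a RATIONAL, `Λ'`-PRIMITIVE class `c'` of type `(p,p)` on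
  `A^{2p}` with `Δ^* c' = c` for the diagonal `Δ = (𝟙, …, 𝟙) : A ⟶ A^{2p}` (degrees `2p - 1 + 1` and `2p` are matched by the
  tree's bookkeeping transport `complexBetti.degCast`, §0).
This is the displayed hypothesis `(PL)` of part XVII with the embedding `(𝟙, 0) : A ⟶ A × B` replaced by the diagonal
`A ⟶ A^{2p}` — part XVII §1 (`IsCMAnchoredDatumFor.comap`, `not_mem_algebraicClasses_of_map_eq`) is stated for ANY
homomorphism, so the successor of part XVII can discharge its K[PL] rows with `(PL-Δ)`; that re-keying is NOT done here.
[cite: Andre1996Motifs, §1.3 (p. 12)] [cite: VoisinHodgeI2002, §6.2.3, §7.1.1 and §11.3.3]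
[cite: LangeBirkenhake1992, §1.4 Thm. 1.4.1 and Thm. 4.2.1] [cite: HatcherAT2002, §3.2 Prop. 3.10 and Example 3.16]
-/

noncomputable section

set_option linter.dupNamespace false

open CategoryTheory
open Literature.AlgebraicTopology.SingularHomology Literature.Geometry.Kaehler
open Literature.AlgebraicGeometry Literature.AlgebraicGeometry.HodgeTheory Literature.AlgebraicGeometry.Motives
open Literature.AlgebraicGeometry.Milne1999

namespace Summit.HodgeConjecture.HodgeConjecture.Ring2.AbelianAll

/-! ## §0 Degree transport is bookkeeping (all by `subst`) -/

section DegCast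

variable {X Z : SchemeOver ℂ}

/-- Rationality is insensitive to degree transport. [folklore] -/
theorem isRationalClass_degCast_iff {a b : ℕ} (h : a = b) (x : complexBetti X a) :
    IsRationalClass (complexBetti.degCast X h x) ↔ IsRationalClass x := by
  subst h; rfl

/-- Hodge type is insensitive to degree transport. [folklore] -/
theorem isOfHodgeType_degCast_iff {n a b : ℕ} (h : a = b) {p q : ℕ} (x : complexBetti X a) :
    IsOfHodgeType n X b p q (complexBetti.degCast X h x) ↔ IsOfHodgeType n X a p q x := by
  subst h; rfl

/-- Primitivity is insensitive to degree transport. [folklore] -/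
theorem degCast_mem_primitiveClasses_iff {a b : ℕ} (h : a = b) (κ : complexBetti X 2) (n : ℕ) (x : complexBetti X a) :
    complexBetti.degCast X h x ∈ primitiveClasses κ n b ↔ x ∈ primitiveClasses κ n a := by
  subst h; rfl

/-- Pull-backs commute with degree transport. [folklore] -/
theorem map_degCast (f : Z ⟶ X) {a b : ℕ} (h : a = b) (x : complexBetti X a) :
    complexBetti.map f b (complexBetti.degCast X h x) = complexBetti.degCast Z h (complexBetti.map f a x) := by
  subst h; rfl

/-- Iterated cup products of degree-one classes, re-indexed along an equality of lengths. [folklore] -/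
theorem cupPowOne_eq_degCast {d d' : ℕ} (h : d = d') (x : Fin d' → complexBetti X 1) :
    cupPowOne ℂ (Motives.ComplexPoints X) d' x =
      complexBetti.degCast X h (cupPowOne ℂ (Motives.ComplexPoints X) d (x ∘ Fin.cast h)) := by
  subst h; rfl

end DegCast

/-! ## §1 The lift preserves rationality -/

/-- **`Φ` maps rational classes to rational classes** — for any `ℂ`-linear `Φ : H^{a+1}(A) → H^{a+1}(Y)` satisfying the
monomial formula of part XXI with respect to maps `T_i : H¹(A) → H¹(Y)` preserving rationality (there: `T_i = prᵢ^*`).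
[cite: LangeBirkenhake1992, §1.4 Thm. 1.4.1] [cite: VoisinHodgeI2002, §7.1.1] [cite: HatcherAT2002, §3.2 Example 3.16] -/
theorem isRationalClass_of_diagonalLift (A : AbelianVariety ℂ) (a : ℕ)
    (Φ : complexBetti A.X (a + 1) →ₗ[ℂ] complexBetti (A.powSucc a).X (a + 1))
    (hΦ : ∀ v : Fin (a + 1) → complexBetti A.X 1,
      Φ (cupPowOne ℂ (Motives.ComplexPoints A.X) (a + 1) v) =
        ((a + 1).factorial : ℂ)⁻¹ • ∑ σ : Equiv.Perm (Fin (a + 1)),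
          ((Equiv.Perm.sign σ : ℤ) : ℂ) • cupPowOne ℂ (Motives.ComplexPoints (A.powSucc a).X) (a + 1)
            (fun i ↦ complexBetti.map (powProj A a i).hom.hom.hom 1 (v (σ i))))
    {x : complexBetti A.X (a + 1)} (hx : IsRationalClass x) : IsRationalClass (Φ x) := by
  classical
  have hXA : IsSmoothProjective A.dim A.X := AbelianVariety.isSmoothProjective_holds
  -- a rational basis `b` of `H¹(A)` and the rational monomials in it
  obtain ⟨r, b, hb⟩ := exists_basis_isRationalClass hXA 1
  set M : Set (complexBetti A.X (a + 1)) :=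
    Set.range fun w : Fin (a + 1) → Fin r ↦ cupPowOne ℂ (Motives.ComplexPoints A.X) (a + 1) (⇑b ∘ w) with hM
  have hMrat : ∀ m ∈ M, IsRationalClass m := by
    rintro _ ⟨w, rfl⟩
    exact isRationalClass_cupPowOne (a + 1) _ fun i ↦ hb (w i)
  have hMspan : Submodule.span ℂ M = ⊤ := span_range_cupPowOne_basis b (a + 1)
  -- `Φ` of a monomial in `b` is rational
  have hΦM : ∀ m ∈ M, IsRationalClass (Φ m) := by
    rintro _ ⟨w, rfl⟩
    rw [hΦ]
    set q₀ : ℚ := ((a + 1).factorial : ℚ)⁻¹ with hq₀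
    have hfac : (q₀ : ℂ) = ((a + 1).factorial : ℂ)⁻¹ := by rw [hq₀, Rat.cast_inv, Rat.cast_natCast]
    rw [← hfac]
    refine IsRationalClass.smul (isRationalClass_sum _ _ fun σ _ ↦ ?_) _
    have hsgn : ((((Equiv.Perm.sign σ : ℤˣ) : ℤ) : ℚ) : ℂ) = ((Equiv.Perm.sign σ : ℤ) : ℂ) := Rat.cast_intCast _
    rw [← hsgn]
    refine IsRationalClass.smul (isRationalClass_cupPowOne (a + 1) _ fun i ↦ ?_) _
    exact (hb (w (σ i))).pullback (AlgPoints.mapContinuous (L := ℂ) (powProj A a i).hom.hom.hom)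
  -- a `ℂ`-basis of `H^{a+1}(A)` inside `M`
  obtain ⟨t, htM, htspan, htli⟩ := exists_linearIndependent ℂ M
  have htfin : t.Finite := (Set.finite_range _).subset htM
  haveI : Fintype t := htfin.fintype
  have htop : ⊤ ≤ Submodule.span ℂ (Set.range (Subtype.val : t → complexBetti A.X (a + 1))) := by
    rw [Subtype.range_coe, htspan, hMspan]
  set B := Module.Basis.mk htli htop with hB
  have hBrat : ∀ i, IsRationalClass (B i) := fun i ↦ by
    rw [hB, Module.Basis.mk_apply]; exact hMrat _ (htM i.2)
  -- rational coordinates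
  have hq : ∀ i, ∃ q : ℚ, (q : ℂ) = B.repr x i := fun i ↦ repr_mem_range_ratCast_of_isRationalClass B hBrat hx i
  choose q hq using hq
  have hxsum : x = ∑ i, ((q i : ℚ) : ℂ) • B i := by
    conv_lhs => rw [← B.sum_repr x]
    exact Finset.sum_congr rfl fun i _ ↦ by rw [hq]
  rw [hxsum, map_sum]
  simp only [map_smul]
  refine IsRationalClass.sum_smul _ (fun i ↦ ?_) q
  rw [hB, Module.Basis.mk_apply]
  exact hΦM _ (htM i.2)

/-! ## §2 The lift preserves Hodge type `(p, p)` -/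

/-- **`Φ` maps `(p,p)`-classes to `(p,p)`-classes** (`a + 1 = 2p`, read through the degree transport of §0): a
`(p,p)`-class of `A` lies in the span of the balanced monomials, and `Φ` of a balanced monomial is a combination of
external products of `p` classes of type `(1,0)` and `p` of type `(0,1)` pulled back from the factors.
[cite: LangeBirkenhake1992, Thm. 4.2.1] [cite: VoisinHodgeI2002, §7.1.1 and §11.3.3] -/
theorem isOfHodgeType_of_diagonalLift (A : AbelianVariety ℂ) (a : ℕ) {p : ℕ} (hp : 0 < p) (e : a + 1 = 2 * p)
    (Φ : complexBetti A.X (a + 1) →ₗ[ℂ] complexBetti (A.powSucc a).X (a + 1))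
    (hΦ : ∀ v : Fin (a + 1) → complexBetti A.X 1,
      Φ (cupPowOne ℂ (Motives.ComplexPoints A.X) (a + 1) v) =
        ((a + 1).factorial : ℂ)⁻¹ • ∑ σ : Equiv.Perm (Fin (a + 1)),
          ((Equiv.Perm.sign σ : ℤ) : ℂ) • cupPowOne ℂ (Motives.ComplexPoints (A.powSucc a).X) (a + 1)
            (fun i ↦ complexBetti.map (powProj A a i).hom.hom.hom 1 (v (σ i))))
    {c : complexBetti A.X (2 * p)} (hc : IsOfHodgeType A.dim A.X (2 * p) p p c) :
    IsOfHodgeType (A.powSucc a).dim (A.powSucc a).X (a + 1) p p (Φ (complexBetti.degCast A.X e.symm c)) := by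
  classical
  have hXA : IsSmoothProjective A.dim A.X := AbelianVariety.isSmoothProjective_holds
  have hX' : IsSmoothProjective (A.powSucc a).dim (A.powSucc a).X := AbelianVariety.isSmoothProjective_holds
  -- the `ℂ`-submodule of classes whose transported lift is of type `(p,p)`
  set S : Submodule ℂ (complexBetti A.X (2 * p)) :=
    (hodgeTypeSubmodule hX' (a + 1) p p).comap (Φ ∘ₗ (complexBetti.degCast A.X e.symm).toLinearMap) with hS
  suffices hcS : c ∈ S by
    rw [hS, Submodule.mem_comap, mem_hodgeTypeSubmodule] at hcS
    exact hcS
  refine AbelianVariety.mem_of_isOfHodgeType_of_balanced_mem A hp S ?_ c hc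
  intro x p' q' _hpq hx hp' hq'
  rw [hS, Submodule.mem_comap, LinearMap.comp_apply, LinearEquiv.coe_toLinearMap, cupPowOne_eq_degCast e x,
    ← complexBetti.degCast_symm e, LinearEquiv.symm_apply_apply, hΦ]
  refine Submodule.smul_mem _ _ (Submodule.sum_mem _ fun σ _ ↦ Submodule.smul_mem _ _ ?_)
  rw [mem_hodgeTypeSubmodule]
  have hw : ∀ i, IsOfHodgeType (A.powSucc a).dim (A.powSucc a).X 1 (p' (Fin.cast e (σ i))) (q' (Fin.cast e (σ i)))
      (complexBetti.map (powProj A a i).hom.hom.hom 1 ((x ∘ Fin.cast e) (σ i))) := fun i ↦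
    (hx (Fin.cast e (σ i))).map_of_isSmoothProjective hX' hXA (powProj A a i).hom.hom.hom
  have key := isOfHodgeType_cupPowOne hX' (Nat.succ_pos a) _ (fun i ↦ p' (Fin.cast e (σ i)))
    (fun i ↦ q' (Fin.cast e (σ i))) hw
  have hperm : ∀ f : Fin (2 * p) → ℕ, ∑ i, f (Fin.cast e (σ i)) = ∑ j, f j := fun f ↦ by
    simpa using Equiv.sum_comp (σ.trans (finCongr e)) f
  rwa [hperm p', hperm q', hp', hq'] at key

/-! ## §3 The primitive lift `(PL-Δ)` -/

/-- **`(PL-Δ)`, general form**: for `a + 1 = 2p`, `p ≥ 1`, `dim A ≥ 1` and a rational `(p,p)`-class `c ∈ H^{2p}(A)` there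
are a hard-Lefschetz datum `Λ'` of `A^{a+1}` and a rational, `Λ'`-primitive `(p,p)`-class `c'` on `A^{a+1}` — of even
dimension `2p · dim A ≥ 2p` — with `Δ^* c' = c`. Parts XXI (the lift), §1, §2, and the tree's `dim_powSucc`; the degree
transport `complexBetti.degCast` only matches `a + 1` with `2p`. NO fact.
[cite: Andre1996Motifs, §1.3 (p. 12)] [cite: VoisinHodgeI2002, §6.2.3 and §11.3.3] [cite: LangeBirkenhake1992, §1.4 and Thm. 4.2.1] -/
theorem primitiveLift_diagonal (A : AbelianVariety ℂ) (hA : 1 ≤ A.dim) (a : ℕ) {p : ℕ} (hp : 0 < p)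
    (e : a + 1 = 2 * p) (c : complexBetti A.X (2 * p)) (hc : IsRationalClass c)
    (hpp : IsOfHodgeType A.dim A.X (2 * p) p p c) :
    ∃ (Λ' : HardLefschetzNFold (A.powSucc a).dim (A.powSucc a).X) (c' : complexBetti (A.powSucc a).X (2 * p)),
      Even (A.powSucc a).dim ∧ 2 * p ≤ (A.powSucc a).dim ∧ IsRationalClass c' ∧
        IsOfHodgeType (A.powSucc a).dim (A.powSucc a).X (2 * p) p p c' ∧
        c' ∈ primitiveClasses Λ'.hyperplaneClass (A.powSucc a).dim (2 * p) ∧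
        complexBetti.map (powLift a fun _ : Fin (a + 1) ↦ 𝟙 A).hom.hom.hom (2 * p) c' = c := by
  obtain ⟨Λ, Φ, hsec, hprim, hmono⟩ := exists_diagonalLift A hA a
  refine ⟨Λ, complexBetti.degCast _ e (Φ (complexBetti.degCast A.X e.symm c)), ?_, ?_, ?_, ?_, ?_, ?_⟩
  · rw [dim_powSucc, e, mul_assoc]; exact even_two_mul _
  · rw [dim_powSucc, e]; exact Nat.le_mul_of_pos_right _ hA
  · rw [isRationalClass_degCast_iff]
    exact isRationalClass_of_diagonalLift A a Φ hmono ((isRationalClass_degCast_iff e.symm c).2 hc)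
  · rw [isOfHodgeType_degCast_iff]; exact isOfHodgeType_of_diagonalLift A a hp e Φ hmono hpp
  · rw [degCast_mem_primitiveClasses_iff]; exact hprim _
  · rw [map_degCast, hsec, complexBetti.degCast_degCast]; exact complexBetti.degCast_rfl c

/-- **`(PL-Δ)`, packaged for the binder ladder**: every rational `(p,p)`-class (`p ≥ 1`) on a complex abelian variety of
positive dimension is the pull-back, along a homomorphism `ι : A ⟶ A'` to an abelian variety of EVEN dimension `≥ 2p`,
of a rational `(p,p)`-class that is primitive for some hard-Lefschetz datum of `A'` (`A' = A^{2p}`, `ι = Δ`). This is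
the displayed `(PL)` of part XVII with `(𝟙, 0) : A ⟶ A × B` replaced by `Δ : A ⟶ A^{2p}`. NO fact.
[cite: Andre1996Motifs, §1.3 (p. 12)] [cite: VoisinHodgeI2002, §6.2.3 and §11.3.3] [cite: LangeBirkenhake1992, §1.4 and Thm. 4.2.1] -/
theorem exists_primitiveLift (A : AbelianVariety ℂ) (hA : 1 ≤ A.dim) {p : ℕ} (hp : 0 < p)
    (c : complexBetti A.X (2 * p)) (hc : IsRationalClass c) (hpp : IsOfHodgeType A.dim A.X (2 * p) p p c) :
    ∃ (A' : AbelianVariety ℂ) (ι : A ⟶ A') (Λ' : HardLefschetzNFold A'.dim A'.X) (c' : complexBetti A'.X (2 * p)),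
      Even A'.dim ∧ 2 * p ≤ A'.dim ∧ IsRationalClass c' ∧ IsOfHodgeType A'.dim A'.X (2 * p) p p c' ∧
        c' ∈ primitiveClasses Λ'.hyperplaneClass A'.dim (2 * p) ∧ complexBetti.map ι.hom.hom.hom (2 * p) c' = c := by
  obtain ⟨Λ', c', h⟩ := primitiveLift_diagonal A hA (2 * p - 1) hp (by omega) c hc hpp
  exact ⟨_, _, Λ', c', h⟩

end Summit.HodgeConjecture.HodgeConjecture.Ring2.AbelianAll
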